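import Literature.Geometry.Lorentzian.KerrBoyerLindquistSliceNormal
import Literature.Geometry.Lorentzian.KerrIngoingCoordChristoffel
import HarnessLib

/-!
# The Boyer–Lindquist slice of Kerr through the ingoing chart, III: the second fundamental form
# in coordinates

Support file, continuing `KerrBoyerLindquistSliceNormal.lean`. In ingoing Kerr coordinates
`u = (t*, r, μ, φ)` the second fundamental form of the Boyer–Lindquist slice `{t = 0}` with respect
to its future unit normal `n = α⁻¹ N₀`, `N₀ = ∂_{t*} + ω ∂_φ` (`ω = 2Mra/A`, `α = √(ΔΣ/A)`), is
computed from the coordinate formula `K(v, w) = g(Dn·ṽ + Γ(n)ṽ, w̃)` (O'Neill 1983, Ch. 4, Lemma 4.4;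
the tree's `OpensChart.secondFundamentalForm_eq_of_repr`), `2 g(Γ(Y)X, Z) = K(Y; X, Z)` the Koszul
form of the rational component field (`Kerr.Ingoing.koszulForm_bilin`):

* `hasGrad_blA`, `hasGrad_blOmega`, `hasFDerivAt_blNormal0`, `fderiv_blNormal_apply` — the
  derivatives `∂A`, `∂ω`, `DN₀ = dω ⊗ ∂_φ`, `Dn = d(α⁻¹) ⊗ N₀ + α⁻¹ dω ⊗ ∂_φ`;
* `blK0` — **the coordinate extrinsic form** `K₀(X, Z) = dω(X) g(∂_φ, Z) + ½ (X¹ ∂_r g(N₀, Z) +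
  X² ∂_μ g(N₀, Z) − ∂_r g(N₀, X) Z¹ − ∂_μ g(N₀, X) Z²)`, and **`bilin_fderiv_blNormal_add_koszul`**:
  `g(Dn·X, Z) + ½ K(n; X, Z) = α⁻¹ K₀(X, Z)` for `Z` tangent to the slice (the `d(α⁻¹)` term drops
  because `g(N₀, Z) = 0`, and `∂_{N₀} g = 0` by stationarity and axisymmetry);
* `blK0_blLift_blLift` — **the closed form on the slice**:
  `K₀(ṽ, w̃) = sin²θ (k₁ (ṙ₁φ̇₂ + φ̇₁ṙ₂) + k₂ (μ̇₁φ̇₂ + φ̇₁μ̇₂))` with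
  `k₁ = −Ma (Σ(r² − a²) + 2r²(r² + a²))/(AΣ)` (`blKrp`) and `k₂ = −2Mra³μΔ/(AΣ)` (`blKmp`), i.e.
  `K = (g_{φφ}/2α)(dω ⊗ dφ_BL + dφ_BL ⊗ dω)`: only the `(r, φ)` and `(θ, φ)` components of the
  extrinsic curvature of the Boyer–Lindquist slice are non-zero.

References: Bardeen–Press–Teukolsky, ApJ 178 (1972) 347, (2.3)–(2.5); Brandt–Seidel, Phys. Rev.
D 52 (1995) 856, (9), and Phys. Rev. D 54 (1996) 1403, §II (extrinsic curvature of the Kerr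
slice); O'Neill 1983, Ch. 3, Prop. 3.13 and Ch. 4, Lemma 4.4; Wald 1984, (10.2.13).
-/

noncomputable section

-- instance search through the nested operator types `E4 →L[ℝ] E4 →L[ℝ] ℝ`
set_option maxSynthPendingDepth 3

open Set Function

namespace Literature.Geometry.Lorentzian

namespace Kerr.Ingoing

variable {M a : ℝ} {u : E4}

/-! ### Derivatives of `Δ`, `A`, `ω`, `N₀` -/

/-- `∂Δ = (2r − 2M) dr`. [folklore] -/
theorem hasGrad_delta (M a : ℝ) (u : E4) :
    HasGrad (fun u : E4 ↦ delta M a (u 1)) u (2 * u 1 - 2 * M) 0 := by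
  have h := (((HasGrad.fst u).sq).sub ((HasGrad.const u (2 * M)).mul (HasGrad.fst u))).add
    (HasGrad.const u (a ^ 2))
  simp only [delta]
  refine h.congr ?_ ?_ <;> ring

/-- `∂_r A`. [cite: arXiv07060622, §5] -/
def blAr (M a : ℝ) (u : E4) : ℝ :=
  2 * u 1 * (sigma a u + (u 1 ^ 2 + a ^ 2)) + 2 * M * a ^ 2 * sinSq u

/-- `∂_μ A = 2a²μΔ`. [cite: arXiv07060622, §5] -/
def blAm (M a : ℝ) (u : E4) : ℝ :=
  2 * a ^ 2 * u 2 * delta M a (u 1)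

/-- `∂A = A_r dr + A_μ dμ`. [cite: arXiv07060622, §5] -/
theorem hasGrad_blA (M a : ℝ) (u : E4) : HasGrad (blA M a) u (blAr M a u) (blAm M a u) := by
  have h := ((((HasGrad.fst u).sq).add (HasGrad.const u (a ^ 2))).mul (hasGrad_sigma (a := a) u)).add
    ((((HasGrad.const u (2 * M)).mul (HasGrad.fst u)).mul (HasGrad.const u (a ^ 2))).mul
      (hasGrad_sinSq u))
  refine h.congr ?_ ?_
  · simp only [blAr, sigma, sinSq]; ring
  · simp only [blAm, sigma, sinSq, delta]; ring

/-- `∂_r ω`. [cite: arXiv07060622, §5] -/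
def blOmegaR (M a : ℝ) (u : E4) : ℝ :=
  (2 * M * a * blA M a u - 2 * M * u 1 * a * blAr M a u) / blA M a u ^ 2

/-- `∂_μ ω`. [cite: arXiv07060622, §5] -/
def blOmegaM (M a : ℝ) (u : E4) : ℝ :=
  -(2 * M * u 1 * a * blAm M a u) / blA M a u ^ 2

/-- `∂ω = ω_r dr + ω_μ dμ` (`A ≠ 0`). [cite: arXiv07060622, §5] -/
theorem hasGrad_blOmega (hA : blA M a u ≠ 0) :
    HasGrad (blOmega M a) u (blOmegaR M a u) (blOmegaM M a u) := by
  have h := (((HasGrad.const u (2 * M)).mul (HasGrad.fst u)).mul (HasGrad.const u a)).div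
    (hasGrad_blA M a u) hA
  refine h.congr ?_ ?_
  · simp only [blOmegaR]; ring
  · simp only [blOmegaM]; ring

/-- `N₀ = ∂_{t*} + ω ∂_φ` as a sum of basis vectors. [cite: arXiv07060622, §5] -/
theorem blNormal0_eq (M a : ℝ) (u : E4) :
    blNormal0 M a u = E4.basisVector 0 + blOmega M a u • E4.basisVector 3 := by
  ext i
  fin_cases i <;> simp [blNormal0]

/-- **`DN₀ = dω ⊗ ∂_φ`** (`A ≠ 0`). [cite: arXiv07060622, §5] -/
theorem hasFDerivAt_blNormal0 (hA : blA M a u ≠ 0) :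
    HasFDerivAt (blNormal0 M a)
      ((blOmegaR M a u • E4.dx 1 + blOmegaM M a u • E4.dx 2).smulRight (E4.basisVector 3)) u := by
  have hfun : blNormal0 M a = fun u ↦ E4.basisVector 0 + blOmega M a u • E4.basisVector 3 :=
    funext (blNormal0_eq M a)
  rw [hfun]
  exact (HasFDerivAt.smul_const (hasGrad_blOmega hA) (E4.basisVector 3 : E4)).const_add
    (E4.basisVector 0 : E4)

/-- The radicand `ΔΣ/A` of the lapse is differentiable (`A ≠ 0`). [cite: arXiv07060622, §5] -/
theorem differentiableAt_lapseSq (hA : blA M a u ≠ 0) :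
    DifferentiableAt ℝ (fun u : E4 ↦ delta M a (u 1) * sigma a u / blA M a u) u :=
  (((hasGrad_delta M a u).mul (hasGrad_sigma (a := a) u)).div (hasGrad_blA M a u) hA).differentiableAt

/-- `α⁻¹` is differentiable where `Δ, Σ, A > 0`. [cite: arXiv07060622, §5] -/
theorem differentiableAt_blLapse_inv (hΔ : 0 < delta M a (u 1)) (hS : 0 < sigma a u)
    (hA : 0 < blA M a u) : DifferentiableAt ℝ (fun u : E4 ↦ (blLapse M a u)⁻¹) u := by
  have hq : 0 < delta M a (u 1) * sigma a u / blA M a u := by positivity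
  unfold blLapse
  exact ((differentiableAt_lapseSq hA.ne').sqrt hq.ne').inv (blLapse_pos hΔ hS hA).ne'

/-- **`Dn = d(α⁻¹) ⊗ N₀ + α⁻¹ dω ⊗ ∂_φ`.** [cite: arXiv07060622, §5] -/
theorem hasFDerivAt_blNormal (hΔ : 0 < delta M a (u 1)) (hS : 0 < sigma a u) (hA : 0 < blA M a u) :
    HasFDerivAt (blNormal M a)
      ((blLapse M a u)⁻¹ • (blOmegaR M a u • E4.dx 1 + blOmegaM M a u • E4.dx 2).smulRight
          (E4.basisVector 3) +
        (fderiv ℝ (fun u : E4 ↦ (blLapse M a u)⁻¹) u).smulRight (blNormal0 M a u)) u := by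
  have hfun : blNormal M a = fun u ↦ (blLapse M a u)⁻¹ • blNormal0 M a u := rfl
  rw [hfun]
  exact (differentiableAt_blLapse_inv hΔ hS hA).hasFDerivAt.smul (hasFDerivAt_blNormal0 hA.ne')

/-- `Dn · X = α⁻¹ dω(X) ∂_φ + (d(α⁻¹)·X) N₀`. [cite: arXiv07060622, §5] -/
theorem fderiv_blNormal_apply (hΔ : 0 < delta M a (u 1)) (hS : 0 < sigma a u) (hA : 0 < blA M a u)
    (X : E4) :
    fderiv ℝ (blNormal M a) u X =
      ((blLapse M a u)⁻¹ * (blOmegaR M a u * X 1 + blOmegaM M a u * X 2)) • E4.basisVector 3 +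
        (fderiv ℝ (fun u : E4 ↦ (blLapse M a u)⁻¹) u X) • blNormal0 M a u := by
  rw [(hasFDerivAt_blNormal hΔ hS hA).fderiv]
  simp only [add_apply, smul_apply, ContinuousLinearMap.smulRight_apply, smul_smul, E4.dx,
    PiLp.proj_apply, smul_eq_mul]

/-! ### The coordinate extrinsic form -/

/-- `∂_r g` is symmetric. [folklore] -/
private theorem bilinR_symm_aux (M a : ℝ) (u v w : E4) : bilinR M a u v w = bilinR M a u w v := by
  rw [bilinR_apply, bilinR_apply]; ring

/-- `∂_μ g` is symmetric. [folklore] -/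
private theorem bilinM_symm_aux (M a : ℝ) (u v w : E4) : bilinM M a u v w = bilinM M a u w v := by
  rw [bilinM_apply, bilinM_apply]; ring

/-- **The coordinate extrinsic form** of the Boyer–Lindquist slice:
`K₀(X, Z) = dω(X) g(∂_φ, Z) + ½ (X¹ ∂_r g(N₀, Z) + X² ∂_μ g(N₀, Z) − ∂_r g(N₀, X) Z¹ − ∂_μ g(N₀, X) Z²)`
(so that `K = α⁻¹ K₀` on slice vectors, `bilin_fderiv_blNormal_add_koszul`). O'Neill 1983, Ch. 4,
Lemma 4.4 with Ch. 3, Prop. 3.13. [cite: ONeill1983, Ch. 4, Lemma 4.4] -/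
def blK0 (M a : ℝ) (u : E4) : E4 →L[ℝ] E4 →L[ℝ] ℝ :=
  E4.tmul (blOmegaR M a u • E4.dx 1 + blOmegaM M a u • E4.dx 2) (bilin M a u (E4.basisVector 3)) +
    (2 : ℝ)⁻¹ • (E4.tmul (E4.dx 1) (bilinR M a u (blNormal0 M a u)) +
      E4.tmul (E4.dx 2) (bilinM M a u (blNormal0 M a u)) -
      E4.tmul (bilinR M a u (blNormal0 M a u)) (E4.dx 1) -
      E4.tmul (bilinM M a u (blNormal0 M a u)) (E4.dx 2))

/-- `K₀(X, Z)` evaluated. [cite: ONeill1983, Ch. 4, Lemma 4.4] -/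
theorem blK0_apply (M a : ℝ) (u X Z : E4) :
    blK0 M a u X Z =
      (blOmegaR M a u * X 1 + blOmegaM M a u * X 2) * bilin M a u (E4.basisVector 3) Z +
        2⁻¹ * (X 1 * bilinR M a u (blNormal0 M a u) Z + X 2 * bilinM M a u (blNormal0 M a u) Z -
          bilinR M a u (blNormal0 M a u) X * Z 1 - bilinM M a u (blNormal0 M a u) X * Z 2) := by
  simp only [blK0, add_apply, sub_apply, smul_apply, E4.tmul_apply, smul_eq_mul, E4.dx,
    PiLp.proj_apply]

/-- **The coordinate formula collapses to `α⁻¹ K₀` on slice vectors**: for `Z = blLift(ṙ, μ̇, φ̇)`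
tangent to the slice, `g(Dn·X, Z) + ½ K(n; X, Z) = α⁻¹ K₀(X, Z)` — the `d(α⁻¹)` term drops since
`g(N₀, Z) = 0`, `K(α⁻¹N₀; X, Z) = α⁻¹ K(N₀; X, Z)`, and `∂_{N₀} g = 0` (the components depend on
`r, μ` only). Requires `Δ, Σ, A > 0` and `μ² ≠ 1`. O'Neill 1983, Ch. 4, Lemma 4.4; Wald 1984,
(10.2.13). [cite: ONeill1983, Ch. 4, Lemma 4.4] -/
theorem bilin_fderiv_blNormal_add_koszul (hΔ : 0 < delta M a (u 1)) (hS : 0 < sigma a u)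
    (hA : 0 < blA M a u) (hs : sinSq u ≠ 0) (X : E4) (rdot mdot pdot : ℝ) :
    bilin M a u (fderiv ℝ (blNormal M a) u X) (blLift M a (u 1) rdot mdot pdot) +
        2⁻¹ * OpensChart.koszulForm (bilin M a) u (blNormal M a u) X (blLift M a (u 1) rdot mdot pdot) =
      (blLapse M a u)⁻¹ * blK0 M a u X (blLift M a (u 1) rdot mdot pdot) := by
  have hreg : u ∈ regularSet a := ⟨hS.ne', hs⟩
  have hn0 := bilin_blNormal0_blLift hΔ.ne' hS.ne' hA.ne' rdot mdot pdot
  have hnfun : blNormal M a u = (blLapse M a u)⁻¹ • blNormal0 M a u := rfl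
  rw [fderiv_blNormal_apply hΔ hS hA, map_add, map_smul, map_smul, add_apply, smul_apply, smul_apply,
    hn0, smul_zero, add_zero, hnfun,
    OpensChart.koszulForm_smul_mid, LinearMap.smul_apply, LinearMap.smul_apply,
    koszulForm_bilin M a hreg, blK0_apply, bilinR_symm_aux M a u X (blNormal0 M a u),
    bilinM_symm_aux M a u X (blNormal0 M a u)]
  simp only [smul_eq_mul, blNormal0_apply_one, blNormal0_apply_two, zero_mul, add_zero]
  ring

/-! ### The closed form on the slice -/

/-- **`k₁ = −Ma(Σ(r² − a²) + 2r²(r² + a²))/(AΣ)`**, the `(r, φ)` coefficient: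
`K₀(∂̃_r, ∂_φ) = sin²θ · k₁` (`= A ω_r/(2Σ)`). Brandt–Seidel 1995, (9); 1996, §II. [cite: BrandtSeidel1996, §II] -/
def blKrp (M a : ℝ) (u : E4) : ℝ :=
  -(M * a * (sigma a u * (u 1 ^ 2 - a ^ 2) + 2 * u 1 ^ 2 * (u 1 ^ 2 + a ^ 2))) /
    (blA M a u * sigma a u)

/-- **`k₂ = −2Mra³μΔ/(AΣ)`**, the `(μ, φ)` coefficient: `K₀(∂_μ, ∂_φ) = sin²θ · k₂`
(`= A ω_μ/(2Σ)`). Brandt–Seidel 1995, (9); 1996, §II. [cite: BrandtSeidel1996, §II] -/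
def blKmp (M a : ℝ) (u : E4) : ℝ :=
  -(2 * M * u 1 * a ^ 3 * u 2 * delta M a (u 1)) / (blA M a u * sigma a u)

/-- **The extrinsic curvature of the Boyer–Lindquist slice in closed form**: on slice vectors
`K₀(blLift(ṙ₁, μ̇₁, φ̇₁), blLift(ṙ₂, μ̇₂, φ̇₂)) = sin²θ (k₁ (ṙ₁φ̇₂ + φ̇₁ṙ₂) + k₂ (μ̇₁φ̇₂ + φ̇₁μ̇₂))`
— only the `(r, φ_BL)` and `(μ, φ_BL)` components survive (`K = (g_{φφ}/2α) (dω dφ + dφ dω)`).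
Requires `Δ, Σ, A ≠ 0`, `μ² ≠ 1`. Brandt–Seidel 1995, (9); Bardeen–Press–Teukolsky 1972, (2.5).
[cite: BrandtSeidel1996, §II] -/
theorem blK0_blLift_blLift (hΔ : delta M a (u 1) ≠ 0) (hS : sigma a u ≠ 0) (hA : blA M a u ≠ 0)
    (hs : sinSq u ≠ 0) (rdot₁ mdot₁ pdot₁ rdot₂ mdot₂ pdot₂ : ℝ) :
    blK0 M a u (blLift M a (u 1) rdot₁ mdot₁ pdot₁) (blLift M a (u 1) rdot₂ mdot₂ pdot₂) =
      sinSq u * (blKrp M a u * (rdot₁ * pdot₂ + pdot₁ * rdot₂) +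
        blKmp M a u * (mdot₁ * pdot₂ + pdot₁ * mdot₂)) := by
  set D := delta M a (u 1) with hD
  set S := sigma a u with hS'
  set A := blA M a u with hA'
  set P := sinSq u with hP
  rw [blK0_apply, bilin_apply, bilinR_apply, bilinR_apply, bilinM_apply, bilinM_apply]
  simp only [blLift_apply_zero, blLift_apply_one, blLift_apply_two, blLift_apply_three,
    blNormal0_apply_zero, blNormal0_apply_one, blNormal0_apply_two, blNormal0_apply_three,
    blSlopeT, blSlopePhi, blOmega, blOmegaR, blOmegaM, blAr, blAm, blKrp, blKmp,
    c13, c22, c33, h00, h03, c22r, c22m, c33r, c33m, h00r, h00m, h03r, h03m, scalarH, scalarHr,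
    scalarHm, E4.basisVector, PiLp.single_apply]
  rw [← hD, ← hS', ← hA', ← hP]
  simp only [Fin.isValue, Fin.reduceEq, ↓reduceIte]
  field_simp
  rw [hD, hS', hA', hP]
  unfold blA delta sigma sinSq
  ring

end Kerr.Ingoing

end Literature.Geometry.Lorentzian

end
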